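import Summits.AtomisticToContinuum.HydrodynamicLimit.Theorems.EnskogAdjointDualityAdjointEnskogTestFamilyROperatorKappaOnePrep
import Summits.AtomisticToContinuum.HydrodynamicLimit.Theorems.EnskogAdjointDualityDualityReductionLMeasurable
import Summits.AtomisticToContinuum.HydrodynamicLimit.Theorems.EnskogAdjointDualityDualityReductionLBound
import Literature.Analysis.FunctionSpaces.PeriodicLogCost
import HarnessLib

/-!
# K2R refutation, stub `operatorKappaOne` — preparation 3: three budgets on `𝕋³ × ℝ³` and `ℝ³`

Route `EnskogAdjointDuality` of `AtomisticToContinuum/HydrodynamicLimit`, crux K2R `AdjointEnskogTestFamilyR`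
(stmt-AtomisticToContinuum-11592), line `refutation`, registered stub `stub_operatorKappaOne` (identity (I):
the corrector part `κ` of the test function against `ζ(s) sin(2πx₀) Θ₁^R(v)`,
`Θ₁^R(v) = |v|(1+|v|²)⁻⁴e^{-|v|²/R} v₀`).  Three self-contained pieces of the assembly:

* `k2r_ref_ok1_prod_integrable` — `Θ₁^R(v) · z sin(2πx₀) · L_κ(x, v)` is integrable on `𝕋³ × ℝ³`
  (measurability of the test-side Enskog operator, `measurable_enskogL_of_continuous`, its growth bound
  `abs_enskogL_le`, and the moment `∫ Θ₁|v₀|(1+|v|²)⁴ < ∞`);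
* `k2r_ref_ok1_k0_fubini` — `∫∫ Θ₀ v₀ sin(2πx₀) κ = ∫ Θ₀(U) U₀ κ_s(U) dU`, `κ_s(U) = ∫ sin(2πx₀) κ(x, U) dx`
  (Fubini on `𝕋³ × ℝ³`; registered keyed sub-goal `stub_operatorKappaOne_prep3`);
* `k2r_ref_ok1_exchange_bound` — the exchange term: `|∫ Θ₁ ∫∫ q₊ M G| ≤ 2080 π C` for `|G| ≤ 2C(1+|w|²)`
  (the flux-moment budget `∫∫ q₊ M (1+|w|²) ≤ 4π(4|v|+9)` and the moments `∫ |v|^k Θ₁ ≤ 20`).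

References: C. Cercignani, R. Illner, M. Pulvirenti, *The Mathematical Theory of Dilute Gases* (1994),
§3.1, §7.2 [CIP1994].
-/

noncomputable section

open MeasureTheory Set Filter Function
open scoped InnerProductSpace Real

namespace Summit.AtomisticToContinuum.HydrodynamicLimit.Theorems.EnskogAdjointDuality

open Literature.MathematicalPhysics.KineticTheory Literature.Analysis.FluidPDE Literature.Analysis.FunctionSpaces
open Literature.Analysis.UnboundedOperators (collisionFrequency)

/-! ## Product integrability on `𝕋³ × ℝ³` -/

/-- **`Θ₁^R · z sin(2πx₀) · L_κ` is integrable on `𝕋³ × ℝ³`.** The test-side Enskog operator `L_κ` of a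
jointly continuous corrector of quadratic growth is measurable in `(x, v)` (`measurable_enskogL_of_continuous`)
with `|L_κ(x, v)| ≤ K(1+|v|²)²` (`abs_enskogL_le`); `Θ₁|v₀|(1+|v|²)⁴ ∈ L¹` closes. [folklore] -/
theorem k2r_ref_ok1_prod_integrable {Y₀ ρ₀ ε C : ℝ} (hρ₀ : 0 ≤ ρ₀) {κ : T3 → V3 → ℝ}
    (hκ : Continuous (uncurry κ)) (hκb : ∀ x v, |κ x v| ≤ C * (1 + ‖v‖ ^ 2)) (Lκ : T3 → V3 → ℝ)
    (hLκ : ∀ x v, Lκ x v = ∫ ω : Metric.sphere (0 : V3) 1, (∫ w : V3,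
      max ⟪v - w, (ω : V3)⟫_ℝ 0 * Y₀ * (ρ₀ * globalMaxwellian w) *
        (κ x (v - ⟪v - w, (ω : V3)⟫_ℝ • (ω : V3)) +
          κ (x + Torus.proj (ε • (ω : V3))) (w + ⟪v - w, (ω : V3)⟫_ℝ • (ω : V3)) -
          κ x v - κ (x + Torus.proj (ε • (ω : V3))) w)) ∂sphereMeasure)
    {R : ℝ} (hR : 1 ≤ R) (z : ℝ) :
    Integrable (fun p : T3 × V3 => (Real.sqrt (‖p.2‖ ^ 2) * ((1 + ‖p.2‖ ^ 2) ^ 4)⁻¹ *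
      Real.exp (-‖p.2‖ ^ 2 / R) * p.2 0) * ((z * Torus.sinCoord 0 p.1) * Lκ p.1 p.2))
      ((volume : Measure T3).prod (volume : Measure V3)) := by
  have hκ' : ∀ {X : Type} [TopologicalSpace X] {f : X → T3} {g : X → V3},
      Continuous f → Continuous g → Continuous fun x => κ (f x) (g x) :=
    fun hf hg => hκ.comp (hf.prodMk hg)
  have hpr := Torus.continuous_proj (d := Fin 3)
  have hys : Continuous (uncurry fun (x : T3) (ω : Metric.sphere (0 : V3) 1) => x + Torus.proj (ε • (ω : V3))) := by
    show Continuous fun p : T3 × Metric.sphere (0 : V3) 1 => p.1 + Torus.proj (ε • (p.2 : V3))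
    fun_prop
  have hL : ∀ (s : ℝ) (x : T3) (v : V3), Lκ x v = (1 : ℝ) * ∫ ω : Metric.sphere (0 : V3) 1, (∫ w : V3,
      max ⟪v - w, (ω : V3)⟫_ℝ 0 * (fun (_ : ℝ) (_ : T3) => Y₀) s x *
        ((fun (_ : ℝ) (_ : T3) => ρ₀) s (x + Torus.proj (ε • (ω : V3))) *
          localMaxwellian 1 ((fun (_ : ℝ) (_ : T3) => (1 : ℝ)) s (x + Torus.proj (ε • (ω : V3))))
            ((fun (_ : ℝ) (_ : T3) => (0 : V3)) s (x + Torus.proj (ε • (ω : V3)))) w) *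
        (κ x (v - ⟪v - w, (ω : V3)⟫_ℝ • (ω : V3)) +
          κ (x + Torus.proj (ε • (ω : V3))) (w + ⟪v - w, (ω : V3)⟫_ℝ • (ω : V3)) -
          κ x v - κ (x + Torus.proj (ε • (ω : V3))) w)) ∂sphereMeasure := fun s x v => by
    simp only [one_mul, localMaxwellian_one_one_zero]
    exact hLκ x v
  have hLm : Measurable fun p : ℝ × T3 × V3 => Lκ p.2.1 p.2.2 :=
    measurable_enskogL_of_continuous (Yf := fun _ _ => Y₀) (g := fun _ _ => ρ₀) (θf := fun _ _ => (1 : ℝ))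
      (uf := fun _ _ => (0 : V3)) (φ := fun (_ : ℝ) x v => κ x v) (xs := fun x _ => x) (lam := 1)
      continuous_const continuous_const continuous_const (fun _ _ => one_pos) continuous_const
      (hκ' continuous_snd.fst continuous_snd.snd) continuous_fst hys (fun _ x v => Lκ x v) hL
  obtain ⟨K, hKnn, hK⟩ := abs_enskogL_le (t := 0) (Yf := fun _ _ => Y₀) (g := fun _ _ => ρ₀)
    (θf := fun _ _ => (1 : ℝ)) (uf := fun _ _ => (0 : V3)) (φ := fun (_ : ℝ) x v => κ x v) (xs := fun x _ => x)
    (Ybar := |Y₀|) (R := ρ₀) (U := 0) (Θ := 1) (Cφ := C) (lam := 1)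
    (fun _ _ _ => le_rfl) (fun _ _ _ => ⟨hρ₀, le_rfl⟩) (fun _ _ _ => norm_zero.le)
    (fun _ _ _ => ⟨one_pos, le_rfl⟩) (fun _ _ x v => hκb x v) (fun _ x v => Lκ x v) hL
  have hK0 : ∀ (x : T3) (v : V3), |Lκ x v| ≤ K * (1 + ‖v‖ ^ 2) ^ 2 :=
    fun x v => hK 0 (left_mem_Icc.2 le_rfl) x v
  have hmeas : Measurable fun p : T3 × V3 => Lκ p.1 p.2 :=
    hLm.comp (measurable_const.prodMk measurable_id : Measurable fun q : T3 × V3 => ((0 : ℝ), q))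
  obtain ⟨-, -, -, -, -, -, -, hi8, -⟩ := k2r_ref_R3_facts hR
  have hsm : Measurable Real.sqrt := Real.continuous_sqrt.measurable
  have hsin := (Torus.isSmooth_sinCoord (0 : Fin 3)).continuous
  refine ((hi8.const_mul (|z| * K)).comp_snd (volume : Measure T3)).mono'
    (Measurable.aestronglyMeasurable (by fun_prop)) (Eventually.of_forall fun p => ?_)
  obtain ⟨x, v⟩ := p
  have hs1 : |Torus.sinCoord 0 x| ≤ 1 := by
    obtain ⟨t, ht⟩ := Torus.exists_coe_eq (x 0)
    rw [Torus.sinCoord_of_eq ht.symm]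
    exact Real.abs_sin_le_one _
  have hth : 0 ≤ Real.sqrt (‖v‖ ^ 2) * ((1 + ‖v‖ ^ 2) ^ 4)⁻¹ * Real.exp (-‖v‖ ^ 2 / R) := by positivity
  have h14 : (1 + ‖v‖ ^ 2) ^ 2 ≤ (1 + ‖v‖ ^ 2) ^ 4 :=
    pow_le_pow_right₀ (by nlinarith [sq_nonneg ‖v‖]) (by norm_num)
  rw [Real.norm_eq_abs]
  dsimp only
  rw [abs_mul, abs_mul, abs_of_nonneg hth]
  calc Real.sqrt (‖v‖ ^ 2) * ((1 + ‖v‖ ^ 2) ^ 4)⁻¹ * Real.exp (-‖v‖ ^ 2 / R) * |v 0| *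
        |z * Torus.sinCoord 0 x * Lκ x v|
      = Real.sqrt (‖v‖ ^ 2) * ((1 + ‖v‖ ^ 2) ^ 4)⁻¹ * Real.exp (-‖v‖ ^ 2 / R) * |v 0| *
        (|z| * |Torus.sinCoord 0 x| * |Lκ x v|) := by rw [abs_mul, abs_mul]
    _ ≤ Real.sqrt (‖v‖ ^ 2) * ((1 + ‖v‖ ^ 2) ^ 4)⁻¹ * Real.exp (-‖v‖ ^ 2 / R) * |v 0| *
        (|z| * 1 * (K * (1 + ‖v‖ ^ 2) ^ 4)) := by
        gcongr
        exact (hK0 x v).trans (mul_le_mul_of_nonneg_left h14 hKnn)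
    _ = |z| * K * (Real.sqrt (‖v‖ ^ 2) * ((1 + ‖v‖ ^ 2) ^ 4)⁻¹ * Real.exp (-‖v‖ ^ 2 / R) * |v 0| *
        (1 + ‖v‖ ^ 2) ^ 4) := by ring

/-! ## The first-moment functional `𝔨₀` -/

/-- **Fubini for `𝔨₀`**: `∫_{𝕋³} ∫ Θ₀^R(v) v₀ sin(2πx₀) κ(x, v) dv dx = ∫ Θ₀^R(U) U₀ κ_s(U) dU` with
`κ_s(U) = ∫ sin(2πx₀) κ(x, U) dx`, and the right-hand integrand is integrable (the integrand is continuous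
on `𝕋³ × ℝ³` and dominated by `C(|v| + |v|³)Θ₀^R(v)`). [folklore] -/
theorem k2r_ref_ok1_k0_fubini {C : ℝ} {κ : T3 → V3 → ℝ} (hκ : Continuous (uncurry κ))
    (hκb : ∀ x v, |κ x v| ≤ C * (1 + ‖v‖ ^ 2)) {κs : V3 → ℝ}
    (hκs : ∀ U, κs U = ∫ x : T3, Torus.sinCoord 0 x * κ x U) {R : ℝ} (hR : 1 ≤ R) :
    Integrable (fun U : V3 => ((1 + ‖U‖ ^ 2) ^ 3)⁻¹ * Real.exp (-‖U‖ ^ 2 / R) * U 0 * κs U) ∧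
    ∫ x : T3, ∫ v : V3, ((1 + ‖v‖ ^ 2) ^ 3)⁻¹ * Real.exp (-‖v‖ ^ 2 / R) * v 0 * Torus.sinCoord 0 x * κ x v =
      ∫ U : V3, ((1 + ‖U‖ ^ 2) ^ 3)⁻¹ * Real.exp (-‖U‖ ^ 2 / R) * U 0 * κs U := by
  obtain ⟨hm, -, ⟨hi3, -⟩, -⟩ := k2r_ref_R3_facts hR
  obtain ⟨hi1, -⟩ := hm 1 (by norm_num)
  have hκc : Continuous fun p : T3 × V3 => κ p.1 p.2 := hκ
  have hsin := (Torus.isSmooth_sinCoord (0 : Fin 3)).continuous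
  set F : T3 × V3 → ℝ := fun p =>
    ((1 + ‖p.2‖ ^ 2) ^ 3)⁻¹ * Real.exp (-‖p.2‖ ^ 2 / R) * p.2 0 * Torus.sinCoord 0 p.1 * κ p.1 p.2 with hFdef
  have hFc : Continuous F := by
    simp only [hFdef]
    fun_prop (disch := intros; positivity)
  have hFb : ∀ p : T3 × V3, |F p| ≤ C * (‖p.2‖ ^ 1 * (((1 + ‖p.2‖ ^ 2) ^ 3)⁻¹ * Real.exp (-‖p.2‖ ^ 2 / R)) +
      ‖p.2‖ ^ 3 * (((1 + ‖p.2‖ ^ 2) ^ 3)⁻¹ * Real.exp (-‖p.2‖ ^ 2 / R))) := by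
    rintro ⟨x, v⟩
    have hv0 : |v 0| ≤ ‖v‖ := by simpa using PiLp.norm_apply_le v 0
    have hs1 : |Torus.sinCoord 0 x| ≤ 1 := by
      obtain ⟨t, ht⟩ := Torus.exists_coe_eq (x 0)
      rw [Torus.sinCoord_of_eq ht.symm]
      exact Real.abs_sin_le_one _
    have hth : 0 ≤ ((1 + ‖v‖ ^ 2) ^ 3)⁻¹ * Real.exp (-‖v‖ ^ 2 / R) := by positivity
    simp only [hFdef]
    rw [abs_mul, abs_mul, abs_mul, abs_of_nonneg hth]
    calc ((1 + ‖v‖ ^ 2) ^ 3)⁻¹ * Real.exp (-‖v‖ ^ 2 / R) * |v 0| * |Torus.sinCoord 0 x| * |κ x v|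
        ≤ ((1 + ‖v‖ ^ 2) ^ 3)⁻¹ * Real.exp (-‖v‖ ^ 2 / R) * ‖v‖ * 1 * (C * (1 + ‖v‖ ^ 2)) := by
          gcongr
          exact hκb x v
      _ = _ := by ring
  have hFi : Integrable F ((volume : Measure T3).prod (volume : Measure V3)) :=
    (((hi1.add hi3).const_mul C).comp_snd (volume : Measure T3)).mono' hFc.aestronglyMeasurable
      (Eventually.of_forall fun p => by rw [Real.norm_eq_abs]; exact hFb p)
  have hslice : ∀ v : V3, ∫ x : T3, F (x, v) = ((1 + ‖v‖ ^ 2) ^ 3)⁻¹ * Real.exp (-‖v‖ ^ 2 / R) * v 0 * κs v := by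
    intro v
    rw [hκs v, ← integral_const_mul]
    exact integral_congr_ae (Eventually.of_forall fun x => by simp only [hFdef]; ring)
  refine ⟨hFi.integral_prod_right.congr (Eventually.of_forall hslice), ?_⟩
  calc ∫ x : T3, ∫ v : V3, ((1 + ‖v‖ ^ 2) ^ 3)⁻¹ * Real.exp (-‖v‖ ^ 2 / R) * v 0 * Torus.sinCoord 0 x * κ x v
      = ∫ x : T3, ∫ v : V3, F (x, v) := rfl
    _ = ∫ v : V3, ∫ x : T3, F (x, v) := integral_integral_swap hFi
    _ = _ := integral_congr_ae (Eventually.of_forall hslice)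

/-- **Registered keyed sub-goal `stub_operatorKappaOne_prep3`** of stub `operatorKappaOne` (line `refutation`
of crux K2R `AdjointEnskogTestFamilyR`): Fubini for the first-moment functional `𝔨₀`. [folklore] -/
theorem stub_operatorKappaOne_prep3 : ∀ (C : ℝ) (κ : UnitAddTorus (Fin 3) → EuclideanSpace ℝ (Fin 3) → ℝ), Continuous (Function.uncurry κ) → (∀ x v, |κ x v| ≤ C * (1 + ‖v‖ ^ 2)) → ∀ R : ℝ, 1 ≤ R → (∫ x : UnitAddTorus (Fin 3), ∫ v : EuclideanSpace ℝ (Fin 3), ((1 + ‖v‖ ^ 2) ^ 3)⁻¹ * Real.exp (-‖v‖ ^ 2 / R) * v 0 * Literature.Analysis.FunctionSpaces.Torus.sinCoord 0 x * κ x v) = ∫ U : EuclideanSpace ℝ (Fin 3), ((1 + ‖U‖ ^ 2) ^ 3)⁻¹ * Real.exp (-‖U‖ ^ 2 / R) * U 0 * ∫ x : UnitAddTorus (Fin 3), Literature.Analysis.FunctionSpaces.Torus.sinCoord 0 x * κ x U :=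
  fun _ κ hκ hκb _ hR => (k2r_ref_ok1_k0_fubini hκ hκb (κs := fun U => ∫ x : T3, Torus.sinCoord 0 x * κ x U)
    (fun _ => rfl) hR).2

/-! ## The exchange term -/

variable {Θ₀ Θ₁ : ℝ → V3 → ℝ} {I₀ I₁ : ℝ → V3 → V3 → ℝ}
variable (hΘ₀ : ∀ R v, Θ₀ R v = ((1 + ‖v‖ ^ 2) ^ 3)⁻¹ * Real.exp (-‖v‖ ^ 2 / R))
  (hΘ₁ : ∀ R v, Θ₁ R v = Real.sqrt (‖v‖ ^ 2) * ((1 + ‖v‖ ^ 2) ^ 4)⁻¹ * Real.exp (-‖v‖ ^ 2 / R) * v 0)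
  (hI₀ : ∀ R U n, I₀ R U n = (1 / 2 : ℝ) * Real.exp (-(‖U‖ ^ 2 - ⟪U, n⟫_ℝ ^ 2) / 2) *
    (∫ b, max (⟪U, n⟫_ℝ - b) 0 * (Real.exp (-b ^ 2 / 2) / Real.sqrt (2 * π))) *
    ∫ E in Ioi (⟪U, n⟫_ℝ ^ 2), ((1 + E) ^ 3)⁻¹ * Real.exp (-E / R))
  (hI₁ : ∀ R U n, I₁ R U n = n 0 * ⟪U, n⟫_ℝ * ((1 / 2 : ℝ) * Real.exp (-(‖U‖ ^ 2 - ⟪U, n⟫_ℝ ^ 2) / 2) *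
    (∫ b, max (⟪U, n⟫_ℝ - b) 0 * (Real.exp (-b ^ 2 / 2) / Real.sqrt (2 * π))) *
    ∫ E in Ioi (⟪U, n⟫_ℝ ^ 2), Real.sqrt E * ((1 + E) ^ 4)⁻¹ * Real.exp (-E / R)))
include hΘ₀ hΘ₁ hI₀ hI₁

omit hΘ₀ hI₀ hI₁ in
/-- **The exchange-term budget.** For a continuous `G` on `S² × ℝ³` with `|G(ω, w)| ≤ 2C(1+|w|²)`:
`v ↦ Θ₁^R(v) ∫∫ q₊ M(w) G(ω, w)` is integrable and `|∫ Θ₁^R ∫∫ q₊ M G| ≤ 2080 π C` (the flux-moment budget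
`∫∫ q₊ M (1+|w|²) ≤ 4π(4|v|+9)`, `|Θ₁^R(v)| ≤ |v| ϑ₁^R(|v|²)`, and `∫ |v|^k ϑ₁^R ≤ 20`, `k = 1, 2`).
[cite: CIP1994, §7.2 (2.13)] -/
theorem k2r_ref_ok1_exchange_bound {R : ℝ} (hR : 1 ≤ R) {G : Metric.sphere (0 : V3) 1 × V3 → ℝ}
    (hG : Continuous G) {C : ℝ} (hC : 0 ≤ C) (hGb : ∀ p, |G p| ≤ 2 * C * (1 + ‖p.2‖ ^ 2)) :
    Integrable (fun v : V3 => Θ₁ R v * ∫ p : Metric.sphere (0 : V3) 1 × V3,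
      max ⟪v - p.2, (p.1 : V3)⟫_ℝ 0 * globalMaxwellian p.2 * G p
      ∂((sphereMeasure : Measure (Metric.sphere (0 : V3) 1)).prod volume)) ∧
    |∫ v : V3, Θ₁ R v * ∫ p : Metric.sphere (0 : V3) 1 × V3,
      max ⟪v - p.2, (p.1 : V3)⟫_ℝ 0 * globalMaxwellian p.2 * G p
      ∂((sphereMeasure : Measure (Metric.sphere (0 : V3) 1)).prod volume)| ≤ 2080 * Real.pi * C := by
  haveI := isFiniteMeasure_sphereMeasure (E := V3)
  have hM := continuous_globalMaxwellian (E := V3)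
  -- the flux budget per velocity
  have hP : ∀ v : V3, |∫ p : Metric.sphere (0 : V3) 1 × V3, max ⟪v - p.2, (p.1 : V3)⟫_ℝ 0 * globalMaxwellian p.2 * G p
      ∂((sphereMeasure : Measure (Metric.sphere (0 : V3) 1)).prod volume)| ≤ 2 * C * (4 * Real.pi * (4 * ‖v‖ + 9)) := by
    intro v
    have hg : Integrable (fun p : Metric.sphere (0 : V3) 1 × V3 =>
        max ⟪v - p.2, (p.1 : V3)⟫_ℝ 0 * globalMaxwellian p.2 * (1 + ‖p.2‖ ^ 2))
        ((sphereMeasure : Measure (Metric.sphere (0 : V3) 1)).prod volume) :=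
      k2r_ref_ko_integrable_piece (G := fun p => 1 + ‖p.2‖ ^ 2) (by fun_prop) zero_le_one v fun p => by
        rw [abs_of_nonneg (by positivity), one_mul]; nlinarith [sq_nonneg ‖v‖]
    have h := norm_integral_le_of_norm_le (hg.const_mul (2 * C))
      (f := fun p : Metric.sphere (0 : V3) 1 × V3 => max ⟪v - p.2, (p.1 : V3)⟫_ℝ 0 * globalMaxwellian p.2 * G p)
      (Eventually.of_forall fun p => by
      have hq0 : 0 ≤ max ⟪v - p.2, (p.1 : V3)⟫_ℝ 0 * globalMaxwellian p.2 :=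
        mul_nonneg (le_max_right _ _) (globalMaxwellian_pos p.2).le
      rw [Real.norm_eq_abs, abs_mul, abs_of_nonneg hq0]
      calc max ⟪v - p.2, (p.1 : V3)⟫_ℝ 0 * globalMaxwellian p.2 * |G p|
          ≤ max ⟪v - p.2, (p.1 : V3)⟫_ℝ 0 * globalMaxwellian p.2 * (2 * C * (1 + ‖p.2‖ ^ 2)) :=
            mul_le_mul_of_nonneg_left (hGb p) hq0
        _ = 2 * C * (max ⟪v - p.2, (p.1 : V3)⟫_ℝ 0 * globalMaxwellian p.2 * (1 + ‖p.2‖ ^ 2)) := by ring)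
    rw [integral_const_mul, Real.norm_eq_abs] at h
    exact h.trans (mul_le_mul_of_nonneg_left (k2r_ref_ko_flux_moment_le v hg) (by positivity))
  -- measurability of the parametric integral
  have hPm : StronglyMeasurable fun v : V3 => ∫ p : Metric.sphere (0 : V3) 1 × V3,
      max ⟪v - p.2, (p.1 : V3)⟫_ℝ 0 * globalMaxwellian p.2 * G p
      ∂((sphereMeasure : Measure (Metric.sphere (0 : V3) 1)).prod volume) := by
    have hc : Continuous fun q : V3 × (Metric.sphere (0 : V3) 1 × V3) =>
        max ⟪q.1 - q.2.2, (q.2.1 : V3)⟫_ℝ 0 * globalMaxwellian q.2.2 * G q.2 := by fun_prop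
    exact hc.stronglyMeasurable.integral_prod_right'
  -- moments of the dipole weight
  obtain ⟨-, hm, -⟩ := k2r_ref_R3_facts hR
  obtain ⟨hi1, hv1⟩ := hm 1 (by norm_num)
  obtain ⟨hi2, hv2⟩ := hm 2 (by norm_num)
  have hΘm : Measurable fun v : V3 => Θ₁ R v := by
    have hsm : Measurable Real.sqrt := Real.continuous_sqrt.measurable
    simp only [hΘ₁]; fun_prop
  have hdom : ∀ v : V3, |Θ₁ R v * ∫ p : Metric.sphere (0 : V3) 1 × V3,
      max ⟪v - p.2, (p.1 : V3)⟫_ℝ 0 * globalMaxwellian p.2 * G p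
      ∂((sphereMeasure : Measure (Metric.sphere (0 : V3) 1)).prod volume)| ≤
      8 * Real.pi * C * (4 * (‖v‖ ^ 2 * (Real.sqrt (‖v‖ ^ 2) * ((1 + ‖v‖ ^ 2) ^ 4)⁻¹ * Real.exp (-‖v‖ ^ 2 / R))) +
        9 * (‖v‖ ^ 1 * (Real.sqrt (‖v‖ ^ 2) * ((1 + ‖v‖ ^ 2) ^ 4)⁻¹ * Real.exp (-‖v‖ ^ 2 / R)))) := by
    intro v
    have hv0 : |v 0| ≤ ‖v‖ := by simpa using PiLp.norm_apply_le v 0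
    have hth : 0 ≤ Real.sqrt (‖v‖ ^ 2) * ((1 + ‖v‖ ^ 2) ^ 4)⁻¹ * Real.exp (-‖v‖ ^ 2 / R) := by positivity
    rw [abs_mul, hΘ₁, abs_mul, abs_of_nonneg hth]
    calc Real.sqrt (‖v‖ ^ 2) * ((1 + ‖v‖ ^ 2) ^ 4)⁻¹ * Real.exp (-‖v‖ ^ 2 / R) * |v 0| *
          |∫ p : Metric.sphere (0 : V3) 1 × V3, max ⟪v - p.2, (p.1 : V3)⟫_ℝ 0 * globalMaxwellian p.2 * G p
            ∂((sphereMeasure : Measure (Metric.sphere (0 : V3) 1)).prod volume)|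
        ≤ Real.sqrt (‖v‖ ^ 2) * ((1 + ‖v‖ ^ 2) ^ 4)⁻¹ * Real.exp (-‖v‖ ^ 2 / R) * ‖v‖ *
          (2 * C * (4 * Real.pi * (4 * ‖v‖ + 9))) := by gcongr; exact hP v
      _ = _ := by ring
  have hRi : Integrable (fun v : V3 =>
      8 * Real.pi * C * (4 * (‖v‖ ^ 2 * (Real.sqrt (‖v‖ ^ 2) * ((1 + ‖v‖ ^ 2) ^ 4)⁻¹ * Real.exp (-‖v‖ ^ 2 / R))) +
        9 * (‖v‖ ^ 1 * (Real.sqrt (‖v‖ ^ 2) * ((1 + ‖v‖ ^ 2) ^ 4)⁻¹ * Real.exp (-‖v‖ ^ 2 / R))))) :=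
    ((hi2.const_mul 4).add (hi1.const_mul 9)).const_mul _
  have hint : Integrable (fun v : V3 => Θ₁ R v * ∫ p : Metric.sphere (0 : V3) 1 × V3,
      max ⟪v - p.2, (p.1 : V3)⟫_ℝ 0 * globalMaxwellian p.2 * G p
      ∂((sphereMeasure : Measure (Metric.sphere (0 : V3) 1)).prod volume)) :=
    hRi.mono' (hΘm.aestronglyMeasurable.mul hPm.aestronglyMeasurable)
      (Eventually.of_forall fun v => by rw [Real.norm_eq_abs]; exact hdom v)
  refine ⟨hint, ?_⟩
  have h := norm_integral_le_of_norm_le hRi (Eventually.of_forall fun v => by rw [Real.norm_eq_abs]; exact hdom v)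
  rw [Real.norm_eq_abs, integral_const_mul, integral_add (hi2.const_mul 4) (hi1.const_mul 9), integral_const_mul,
    integral_const_mul] at h
  refine h.trans ?_
  nlinarith [Real.pi_pos, hv1, hv2, mul_nonneg Real.pi_pos.le hC]

end Summit.AtomisticToContinuum.HydrodynamicLimit.Theorems.EnskogAdjointDuality
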